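import Summits.AtomisticToContinuum.HydrodynamicLimit.Theses.LambertianContactSwap
import Summits.AtomisticToContinuum.HydrodynamicLimit.Theorems.LambertianContactSwapSwapGapFieldConcentrationOfLD
import Summits.AtomisticToContinuum.HydrodynamicLimit.Theorems.LambertianContactSwapSwapGapEntropyTransfer
import Summits.AtomisticToContinuum.HydrodynamicLimit.Theorems.OneFlightGossipEngineUniformLocalGibbsConcentration
import HarnessLib

/-!
# `SwapGap` (stmt-AtomisticToContinuum-11850), line `Sketch`: rung R0 — STATIC field concentration under local Gibbs laws

Helper file (`--supports stmt-AtomisticToContinuum-11850`) of line `Sketch` (card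
`entropy-relative-to-lambertian-law`) for the crux
`Summit.AtomisticToContinuum.HydrodynamicLimit.Theses.LambertianContactSwap.SwapGap`, registered helper
stub `stub_fieldConcentration_static` (rung R0) of the lead's skeleton: under the local Gibbs law
`P_N = localGibbsLaw σ a₀ u₀ θ₀ N Φ` ITSELF (no dynamics), every `1`-Lipschitz statistic `F` bounded by
`1` of the `χ`-tested field triple `(density, momentum, energy)` concentrates exponentially (speed
`N + 1`) around its own `P_N`-mean, uniformly in `N` AND in the flow `Φ` (the law does not depend on
the flow). This is the common source of the two rungs where the research stub S2 of the line is
already a theorem (`t = 0` and equilibrium).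

Proof. The landed `η₀`-uniform exponential law of large numbers for canonical local Gibbs states
(`uniformLocalGibbsConcentration_proof`, stmt-14445) gives, under the density guard
`σ³ · sup a₀ ≤ η₀ ∫ a₀`, exponential concentration of the three fields around the static limits
`∫χρ₀`, `∫(χρ₀) • u₀`, `∫χ E(ρ₀, u₀, θ₀)`, uniformly in `N, Φ`. For FIXED profiles the guard holds for
all `σ ≤ σ₁ := min 1 (η₀ ∫a₀ / sup a₀)`; we take `σ₀ := min (1/2) σ₁`. A union bound for the sup
distance on the triple and `|F(X) − F(c)| ≤ dist(X, c)` give concentration of `F ∘ fld` around the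
constant `F(c)` with constant `3C`; the abstract bookkeeping lemma
`expConc_sub_integral_uniform` (the `(N, Φ)`-indexed version of
`expConc_sub_integral_of_expConc_sub_const`: `|∫G − c| ≤ δ/4 + 2 C e^{-(N+1)/C}` pointwise in the
index, `N₀` depends only on `C, δ`, small `N` absorbed into the constant) turns it into concentration
around the mean.

prover-line-stmt-AtomisticToContinuum-11850-c3-0, wave 5.
-/

noncomputable section

open MeasureTheory Filter Set Topology
open scoped ENNReal

namespace Summit.AtomisticToContinuum.HydrodynamicLimit.Theorems

open Literature.Analysis.FluidPDE Literature.MathematicalPhysics.KineticTheory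

/-! ### Abstract bookkeeping, uniformly over an index -/

/-- **Exponential concentration around constants gives exponential concentration around the mean,
uniformly over an index.** On probability spaces `(Ω_N, μ_{N,i})` indexed by `N : ℕ` and `i : ι N`, let
`G_{N,i}` be measurable with `|G_{N,i}| ≤ 1` and `c_{N,i} ∈ [-1, 1]`. If for every `δ > 0` there is
`C > 0` with `μ_{N,i}{δ < |G_{N,i} − c_{N,i}|} ≤ C e^{-(N+1)/C}` for all `N, i`, then for every `δ > 0`
there is `C > 0` with `μ_{N,i}{δ < |G_{N,i} − ∫ G_{N,i} dμ_{N,i}|} ≤ C e^{-(N+1)/C}` for all `N, i`.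
Proof: `|∫ G − c| ≤ δ/4 + 2 μ{δ/4 < |G − c|} ≤ δ/4 + 2Ce^{-(N+1)/C}` pointwise in `(N, i)`, so for
`N ≥ N₀(C, δ)` the event `{δ < |G − mean|}` lies in `{δ/4 < |G − c|}`; the finitely many `N < N₀` are
absorbed by taking the constant `≥ max(N₀, 3)` (adapted from
`expConc_sub_integral_of_expConc_sub_const`, same argument with the extra index). [folklore] -/
theorem expConc_sub_integral_uniform {Ω ι : ℕ → Type*} [∀ N, MeasurableSpace (Ω N)]
    (μ : (N : ℕ) → ι N → Measure (Ω N)) (hμ : ∀ N i, IsProbabilityMeasure (μ N i))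
    (G : (N : ℕ) → ι N → Ω N → ℝ) (hG : ∀ N i, Measurable (G N i))
    (hGb : ∀ N i x, |G N i x| ≤ 1) (c : (N : ℕ) → ι N → ℝ) (hc : ∀ N i, |c N i| ≤ 1)
    (h : ∀ δ : ℝ, 0 < δ → ∃ C : ℝ, 0 < C ∧ ∀ (N : ℕ) (i : ι N),
      μ N i {x | δ < |G N i x - c N i|} ≤ ENNReal.ofReal (C * Real.exp (-(C⁻¹ * ((N : ℝ) + 1)))))
    {δ : ℝ} (hδ : 0 < δ) :
    ∃ C : ℝ, 0 < C ∧ ∀ (N : ℕ) (i : ι N),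
      μ N i {x | δ < |G N i x - ∫ y, G N i y ∂μ N i|} ≤
        ENNReal.ofReal (C * Real.exp (-(C⁻¹ * ((N : ℝ) + 1)))) := by
  obtain ⟨C, hC, hCN⟩ := h (δ / 4) (by positivity)
  set r : ℕ → ℝ := fun N => C * Real.exp (-(C⁻¹ * ((N : ℝ) + 1))) with hr
  have hr0 : ∀ N, 0 ≤ r N := fun N => by positivity
  -- the mean is close to the centre, pointwise in `(N, i)`
  have hmean : ∀ N i, |(∫ y, G N i y ∂μ N i) - c N i| ≤ δ / 4 + 2 * r N := by
    intro N i
    haveI := hμ N i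
    set S : Set (Ω N) := {x | δ / 4 < |G N i x - c N i|} with hS
    have hSm : MeasurableSet S :=
      measurableSet_lt measurable_const ((hG N i).sub measurable_const).abs
    have hμS : (μ N i).real S ≤ r N := ENNReal.toReal_le_of_le_ofReal (hr0 N) (hCN N i)
    have hGi : Integrable (G N i) (μ N i) :=
      Integrable.of_bound (hG N i).aestronglyMeasurable 1 (ae_of_all _ fun x => by
        rw [Real.norm_eq_abs]; exact hGb N i x)
    have hpt : ∀ x, |G N i x - c N i| ≤ S.indicator (fun _ => (2 : ℝ)) x + δ / 4 := by
      intro x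
      by_cases hx : δ / 4 < |G N i x - c N i|
      · have hmem : x ∈ S := hx
        rw [Set.indicator_of_mem hmem]
        have h3 : |G N i x - c N i| ≤ |G N i x| + |c N i| := abs_sub _ _
        linarith [hGb N i x, hc N i]
      · have hmem : x ∉ S := hx
        rw [Set.indicator_of_notMem hmem, zero_add]
        exact not_lt.1 hx
    have hint : (∫ y, G N i y ∂μ N i) - c N i = ∫ y, (G N i y - c N i) ∂μ N i := by
      rw [integral_sub hGi (integrable_const _), integral_const, probReal_univ, one_smul]
    have hgi : Integrable (fun x => S.indicator (fun _ => (2 : ℝ)) x + δ / 4) (μ N i) :=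
      ((integrable_const (2 : ℝ)).indicator hSm).add (integrable_const _)
    calc |(∫ y, G N i y ∂μ N i) - c N i| = |∫ y, (G N i y - c N i) ∂μ N i| := by rw [hint]
      _ ≤ ∫ y, |G N i y - c N i| ∂μ N i := abs_integral_le_integral_abs
      _ ≤ ∫ y, (S.indicator (fun _ => (2 : ℝ)) y + δ / 4) ∂μ N i :=
          integral_mono_of_nonneg (ae_of_all _ fun y => abs_nonneg _) hgi (ae_of_all _ hpt)
      _ = 2 * (μ N i).real S + δ / 4 := by
          rw [integral_add ((integrable_const (2 : ℝ)).indicator hSm) (integrable_const _),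
            integral_indicator_const _ hSm, integral_const, probReal_univ, smul_eq_mul, smul_eq_mul,
            mul_comm, one_mul]
      _ ≤ δ / 4 + 2 * r N := by linarith
  -- eventually `2 r_N ≤ δ/2` (the threshold depends only on `C, δ`)
  have hev : ∀ᶠ N : ℕ in atTop, 2 * r N ≤ δ / 2 := by
    have ht : Tendsto (fun N => 2 * r N) atTop (𝓝 (2 * 0)) :=
      (tendsto_const_mul_exp_neg_succ C hC).const_mul 2
    rw [mul_zero] at ht
    exact ht.eventually (ge_mem_nhds (by positivity))
  obtain ⟨N₀, hN₀⟩ := eventually_atTop.1 hev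
  -- the constant
  set C' : ℝ := max C (max (N₀ : ℝ) 3) with hC'
  have hCC' : C ≤ C' := le_max_left _ _
  have hC'3 : (3 : ℝ) ≤ C' := (le_max_right _ _).trans (le_max_right _ _)
  have hC'N₀ : (N₀ : ℝ) ≤ C' := (le_max_left _ _).trans (le_max_right _ _)
  have hC'pos : 0 < C' := hC.trans_le hCC'
  refine ⟨C', hC'pos, fun N i => ?_⟩
  haveI := hμ N i
  by_cases hN : N₀ ≤ N
  · -- large `N`: the event is inside `{δ/4 < |G − c|}`
    have hsub : {x | δ < |G N i x - ∫ y, G N i y ∂μ N i|} ⊆ {x | δ / 4 < |G N i x - c N i|} := by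
      intro x hx
      simp only [mem_setOf_eq] at hx ⊢
      have hm := hmean N i
      have h2 := hN₀ N hN
      have htri : |G N i x - ∫ y, G N i y ∂μ N i| ≤
          |G N i x - c N i| + |(∫ y, G N i y ∂μ N i) - c N i| := by
        have := abs_sub_le (G N i x) (c N i) (∫ y, G N i y ∂μ N i)
        rw [abs_sub_comm (c N i)] at this
        exact this
      linarith
    calc μ N i {x | δ < |G N i x - ∫ y, G N i y ∂μ N i|}
        ≤ μ N i {x | δ / 4 < |G N i x - c N i|} := measure_mono hsub
      _ ≤ ENNReal.ofReal (r N) := hCN N i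
      _ ≤ ENNReal.ofReal (C' * Real.exp (-(C'⁻¹ * ((N : ℝ) + 1)))) :=
          ENNReal.ofReal_le_ofReal (UniformLGC.Kexp_le_Kexp hC hCC' (by positivity))
  · -- small `N`: the bound is at least `1`
    have hN' : (N : ℝ) + 1 ≤ N₀ := by exact_mod_cast Nat.lt_of_not_le hN
    have hexp : Real.exp (-1) ≤ Real.exp (-(C'⁻¹ * ((N : ℝ) + 1))) := by
      refine Real.exp_le_exp.2 ?_
      have h1 : C'⁻¹ * ((N : ℝ) + 1) ≤ C'⁻¹ * C' :=
        mul_le_mul_of_nonneg_left (hN'.trans hC'N₀) (inv_nonneg.2 hC'pos.le)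
      rw [inv_mul_cancel₀ hC'pos.ne'] at h1
      linarith
    have he : (1 : ℝ) ≤ 3 * Real.exp (-1) := by
      have := Real.exp_one_lt_d9
      have h1 : Real.exp (-1) = (Real.exp 1)⁻¹ := Real.exp_neg 1
      rw [h1, ← div_eq_mul_inv, le_div_iff₀ (Real.exp_pos 1)]
      linarith
    have hone : (1 : ℝ) ≤ C' * Real.exp (-(C'⁻¹ * ((N : ℝ) + 1))) := by
      calc (1 : ℝ) ≤ 3 * Real.exp (-1) := he
        _ ≤ C' * Real.exp (-(C'⁻¹ * ((N : ℝ) + 1))) :=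
            mul_le_mul hC'3 hexp (Real.exp_pos _).le hC'pos.le
    calc μ N i {x | δ < |G N i x - ∫ y, G N i y ∂μ N i|} ≤ 1 := prob_le_one
      _ ≤ ENNReal.ofReal (C' * Real.exp (-(C'⁻¹ * ((N : ℝ) + 1)))) :=
          ENNReal.one_le_ofReal.2 hone

/-! ### Rung R0: static exponential self-averaging of field statistics under local Gibbs laws -/

/-- **R0 · STATIC FIELD CONCENTRATION UNDER LOCAL GIBBS LAWS.** For continuous profiles
`a₀, θ₀ > 0`, `u₀` there is `σ₀ > 0` such that for `0 < σ < σ₀`, every continuous `χ`, every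
`1`-Lipschitz `F` bounded by `1` and every `δ > 0` there is `C > 0` with
`P_N{δ < |F(fld(z, χ)) − ∫ F(fld) dP_N|} ≤ C e^{−(N+1)/C}` for ALL `N` and ALL flows `Φ`, where
`P_N = localGibbsLaw σ a₀ u₀ θ₀ N Φ`. From the `η₀`-uniform exponential law of large numbers
`uniformLocalGibbsConcentration_proof` (its density guard `σ³ sup a₀ ≤ η₀ ∫ a₀` holds for
`σ ≤ min 1 (η₀ ∫a₀ / sup a₀)`), a union bound over the three fields around the static limits
`∫χρ₀, ∫(χρ₀) • u₀, ∫χE₀` (sup distance on the triple, `F` is `1`-Lipschitz), then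
`expConc_sub_integral_uniform`. [folklore] -/
theorem stub_fieldConcentration_static :
    ∀ (a₀ θ₀ : T3 → ℝ) (u₀ : T3 → V3), Continuous a₀ → Continuous θ₀ → Continuous u₀ →
      (∀ x, 0 < a₀ x) → (∀ x, 0 < θ₀ x) →
      ∃ σ₀ : ℝ, 0 < σ₀ ∧ ∀ σ : ℝ, 0 < σ → σ < σ₀ →
        ∀ χ : T3 → ℝ, Continuous χ → ∀ F : ℝ × V3 × ℝ → ℝ, LipschitzWith 1 F → (∀ y, |F y| ≤ 1) →
          ∀ δ : ℝ, 0 < δ → ∃ C : ℝ, 0 < C ∧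
            ∀ (N : ℕ) (Φ : HardSphereFlow (Torus.geometry (Fin 3)) (hsDiameter σ N) (N + 1)),
              (localGibbsLaw σ a₀ u₀ θ₀ N Φ)
                  {z | δ < |F (empiricalDensityField z χ, empiricalMomentumField z χ, empiricalEnergyField z χ) -
                    ∫ w, F (empiricalDensityField w χ, empiricalMomentumField w χ, empiricalEnergyField w χ)
                      ∂(localGibbsLaw σ a₀ u₀ θ₀ N Φ)|} ≤
                ENNReal.ofReal (C * Real.exp (-(C⁻¹ * ((N : ℝ) + 1)))) := by
  obtain ⟨η₀, hη₀, hU⟩ := uniformLocalGibbsConcentration_proof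
  intro a₀ θ₀ u₀ ha hθ hu ha0 hθ0
  -- the supremum and the integral of the activity
  have hbdd : BddAbove (Set.range a₀) := (isCompact_range ha).bddAbove
  have hsup_ge : ∀ x, a₀ x ≤ ⨆ y, a₀ y := fun x => le_ciSup hbdd x
  have hS : 0 < ⨆ y, a₀ y := (ha0 0).trans_le (hsup_ge 0)
  have hI : 0 < ∫ y, a₀ y := integral_pos_of_continuous_pos ha ha0
  -- the threshold: `σ ≤ σ₁` implies the density guard of `uniformLocalGibbsConcentration_proof`
  set σ₁ : ℝ := min 1 (η₀ * (∫ y, a₀ y) / ⨆ y, a₀ y) with hσ₁def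
  have hσ₁ : 0 < σ₁ := lt_min one_pos (by positivity)
  refine ⟨min 2⁻¹ σ₁, lt_min (by norm_num) hσ₁, ?_⟩
  intro σ hσ hσlt χ hχ F hF hF1 δ hδ
  have hσσ₁ : σ < σ₁ := hσlt.trans_le (min_le_right _ _)
  have hσ1 : σ ≤ 1 := hσσ₁.le.trans (min_le_left _ _)
  have hσq : σ ≤ η₀ * (∫ y, a₀ y) / ⨆ y, a₀ y := hσσ₁.le.trans (min_le_right _ _)
  have hguard : σ ^ 3 * (⨆ y, a₀ y) ≤ η₀ * ∫ y, a₀ y := by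
    have h3 : σ ^ 3 ≤ σ := by
      have := pow_le_pow_of_le_one hσ.le hσ1 (by norm_num : 1 ≤ 3)
      simpa using this
    calc σ ^ 3 * (⨆ y, a₀ y) ≤ σ * ⨆ y, a₀ y := mul_le_mul_of_nonneg_right h3 hS.le
      _ ≤ (η₀ * (∫ y, a₀ y) / ⨆ y, a₀ y) * ⨆ y, a₀ y := mul_le_mul_of_nonneg_right hσq hS.le
      _ = η₀ * ∫ y, a₀ y := div_mul_cancel₀ _ hS.ne'
  obtain ⟨ρ₀, -, -, hP, hconc⟩ := hU a₀ θ₀ u₀ ha hθ hu ha0 hθ0 σ hσ hguard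
  have hconcχ := hconc χ hχ
  -- notation
  set X : (N : ℕ) → Config (N + 1) (Fin 3) T3 → ℝ × V3 × ℝ :=
    fun N z => (empiricalDensityField z χ, empiricalMomentumField z χ, empiricalEnergyField z χ)
    with hX
  set c : ℝ × V3 × ℝ := (∫ x, χ x * ρ₀ x, ∫ x, (χ x * ρ₀ x) • u₀ x,
    ∫ x, χ x * totalEnergyDensity (ρ₀ x) (u₀ x) (θ₀ x)) with hc
  have hXm : ∀ N, Measurable (X N) := fun N => measurable_fieldTriple hχ
  -- exponential concentration of `F ∘ X` around the constant `F c`, uniformly in `N, Φ`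
  have hconst : ∀ δ' : ℝ, 0 < δ' → ∃ C : ℝ, 0 < C ∧
      ∀ (N : ℕ) (Φ : HardSphereFlow (Torus.geometry (Fin 3)) (hsDiameter σ N) (N + 1)),
        localGibbsLaw σ a₀ u₀ θ₀ N Φ {z | δ' < |F (X N z) - F c|} ≤
          ENNReal.ofReal (C * Real.exp (-(C⁻¹ * ((N : ℝ) + 1)))) := by
    intro δ' hδ'
    obtain ⟨C, hC, hCN⟩ := hconcχ δ' hδ'
    refine ⟨3 * C, by positivity, fun N Φ => ?_⟩
    have hsub : {z | δ' < |F (X N z) - F c|} ⊆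
        {z | δ' < |(X N z).1 - c.1|} ∪ {z | δ' < ‖(X N z).2.1 - c.2.1‖} ∪
          {z | δ' < |(X N z).2.2 - c.2.2|} := by
      intro z hz
      simp only [mem_setOf_eq] at hz
      have hd : δ' < dist (X N z) c := by
        have h1 : dist (F (X N z)) (F c) ≤ dist (X N z) c := by
          simpa using hF.dist_le_mul (X N z) c
        rw [Real.dist_eq] at h1
        exact hz.trans_le h1
      rw [Prod.dist_eq, Prod.dist_eq, Real.dist_eq, dist_eq_norm, Real.dist_eq] at hd
      simp only [mem_union, mem_setOf_eq]
      rcases lt_max_iff.1 hd with h | h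
      · exact Or.inl (Or.inl h)
      · rcases lt_max_iff.1 h with h' | h'
        · exact Or.inl (Or.inr h')
        · exact Or.inr h'
    obtain ⟨hD, hM, hEn⟩ := hCN N Φ
    calc localGibbsLaw σ a₀ u₀ θ₀ N Φ {z | δ' < |F (X N z) - F c|}
        ≤ localGibbsLaw σ a₀ u₀ θ₀ N Φ {z | δ' < |(X N z).1 - c.1|} +
            localGibbsLaw σ a₀ u₀ θ₀ N Φ {z | δ' < ‖(X N z).2.1 - c.2.1‖} +
            localGibbsLaw σ a₀ u₀ θ₀ N Φ {z | δ' < |(X N z).2.2 - c.2.2|} :=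
          (measure_mono hsub).trans
            ((measure_union_le _ _).trans (add_le_add (measure_union_le _ _) le_rfl))
      _ ≤ ENNReal.ofReal (C * Real.exp (-(C⁻¹ * ((N : ℝ) + 1)))) +
            ENNReal.ofReal (C * Real.exp (-(C⁻¹ * ((N : ℝ) + 1)))) +
            ENNReal.ofReal (C * Real.exp (-(C⁻¹ * ((N : ℝ) + 1)))) :=
          add_le_add (add_le_add hD hM) hEn
      _ = ENNReal.ofReal (3 * (C * Real.exp (-(C⁻¹ * ((N : ℝ) + 1))))) := by
          rw [← ENNReal.ofReal_add (by positivity) (by positivity),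
            ← ENNReal.ofReal_add (by positivity) (by positivity)]
          ring_nf
      _ ≤ ENNReal.ofReal (3 * C * Real.exp (-((3 * C)⁻¹ * ((N : ℝ) + 1)))) := by
          refine ENNReal.ofReal_le_ofReal ?_
          rw [mul_assoc]
          refine mul_le_mul_of_nonneg_left (mul_le_mul_of_nonneg_left (Real.exp_le_exp.2 ?_) hC.le)
            (by norm_num)
          have h3 : (3 * C)⁻¹ ≤ C⁻¹ := inv_anti₀ hC (by linarith)
          have hN : (0 : ℝ) ≤ (N : ℝ) + 1 := by positivity
          nlinarith
  -- around the mean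
  have hmain := expConc_sub_integral_uniform (fun N Φ => localGibbsLaw σ a₀ u₀ θ₀ N Φ) hP
    (fun N _ z => F (X N z)) (fun N _ => hF.continuous.measurable.comp (hXm N))
    (fun N _ z => hF1 _) (fun _ _ => F c) (fun _ _ => hF1 c) hconst hδ
  simpa only [hX] using hmain

end Summit.AtomisticToContinuum.HydrodynamicLimit.Theorems
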